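import Summits.QuantumFields.YangMills.Theorems.BalabanUVNodesN15CovariantLandauLipschitzLetter
import Summits.QuantumFields.YangMills.Theorems.BalabanUVNodesN15CovariantAveragingHolonomyFit
import HarnessLib

/-!
# Route «BalabanUVNodes», node N15 = NE2, road (c) — PROGRAMME (P-S), XL: THE TWO-GRID OSCILLATION LETTER `ω_N` OF THE KNIT's TRANSPORTERS FROM (3.35) — the second-order
# expansion `n(Ad_{e^{A/n}} − 1) = ad_A + O(r²/n)` of the adjoint action and the block-mean fit `|A′ − Ā∘pr| ≤ 2(d+1)(L^m−1)·ℓ′` (dag-n15-c g25, n15-c∕247)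

Cell `pub-ymgap`, seat `pub-ymgap-dag-n15-c` (generation g25; R134 (a), s1; HUMAN RULING D-0062; chair R424 venue).  `bears_on: R4∕N15 · K3⁸ SpineGivenEndpointR13SepCoPHV
(stmt-QuantumFields-27366)`; filed `--supports stmt-QuantumFields-27366 --as helper` — COUNT-NEUTRAL.  Theorems only; 0 `sorry`.  Imports BY NAME n15-c∕226 (context: `cvT₀`, the exp letters
`norm_exp_sub_one_sub_self_le`, `norm_exp_sub_exp_le`, `norm_exp_sub_exp_sub_sub_le`), n15-c∕185b (`norm_sub_gavgM_kingPrV_le`: the fibre oscillation of King block means),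
`CurvedSpecies.conjTranspose_exp_smul_of_conjTranspose`, `CurvedSpecies.abs_coordMat_entry_le`, `coordMat_one∕_sub∕_smul`.  Nothing in the tree is modified.

WHY.  n15-c∕243 `hasMaj_idef_cvNVr_of_rows` (the two-grid η-defect row of `N_V^R`) displays the OSCILLATION LETTER `ω_N`: rows and columns of `N′_ν(x′) − N_ν(pr x′)`, `N = n(1 − T)`,
`T = coordMat e Ad_{e^{A/n}}`, between the fine field `A′` at spacing `1/n′` and its King block mean `Ā = gavgM π̂ A′` at spacing `1/n`.  Since `n(1 − Ad_{e^{A/n}}) = −ad_A + O(r²/n)`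
(second order of the exponential, uniformly in the algebra norm), `N′ − N∘pr = −(ad_{A′} − ad_{Ā∘pr}) + O(r²/n) + O(r²/n′)`, and `|A′(x′) − Ā(pr x′)| ≤ 2(d+1)(L^m − 1)·ℓ′` with `ℓ′`
the unit-step size of `A′` ((3.35)'s second member: `ℓ′ ≤ r/n′`, so the fit is `≤ 2(d+1)·r/n`): `ω_N = O(r/n)` — the η-rate.
* §1 (any complete normed algebra) `exp_le_three_of_le_one`, `norm_conj_exp_sub_sub_comm_le` (`‖e^PXe^{−P} − X − [P, X]‖ ≤ 8ρ²‖X‖`, `‖P‖ ≤ ρ ≤ 1`), `norm_conj_exp_sub_conj_exp_sub_comm_le` (two points: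
  `‖e^PXe^{−P} − e^QXe^{−Q} − [P − Q, X]‖ ≤ 16ρ‖P − Q‖‖X‖`), ★ `norm_scaledAd_two_grid_le` (`‖n′(1 − Ad_{e^{B′/n′}}) − n(1 − Ad_{e^{B/n}})‖ ≤ 2‖B′ − B‖ + 8r²(1/n′ + 1/n)`),
  ★ `norm_scaledAdDiff_sub_comm_le` (`‖n²(Ad_{e^{B₁/n}} − Ad_{e^{B₂/n}}) − ad_{n(B₁−B₂)}‖ ≤ 16r‖B₁ − B₂‖`: the gradient word, for n15-c∕249's `ω_V`);
* §2 (`M_m(ℂ)`, the knit's `cvT₀`) ★★ `omegaN_entry_le`, ★★ `omegaN_rows_le`, ★★ `omegaN_cols_le`: 243's `hωNr`∕`hωNc` letters `≤ |ι|·κ_e·(2·2(d+1)(L^m−1)·ℓ′ + 8r²(1/n′ + 1/n))`.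

HONEST FRAMING ∕ LIMITS.  Real-analysis bookkeeping (Taylor to second order + block-mean oscillation); MODEL transporters (site data `e^{A/n}`); NOT [Balaban1985BackgroundPropagators]
Lemma 3.3 ∕ Thm 3.4 ∕ Thm 3.14 as printed; NE2⁺ NOT PRINTED; N15 of record untouched (DISCHARGED AS CONSUMED, p687738); counts UNMOVED (typed 28∕28 · discharged 8∕27); one finite 𝕋⁴ at
fixed ε per index — NOT infinite volume ∕ OS ∕ mass gap ∕ Clay.  Restate-immune (no Theses import).
-/

noncomputable section

open scoped BigOperators Matrix

/-! ## §1 Second order of the adjoint action of an exponential, in any complete normed algebra -/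

namespace Summit.QuantumFields.YangMills.BalabanUVNodes.N15.MatrixSpecies

open NormedSpace
open Literature.Analysis.Calculus (norm_exp_sub_one_le)

section AdExpansion

variable {𝔸 : Type*} [NormedRing 𝔸] [NormedAlgebra ℝ 𝔸] [CompleteSpace 𝔸]

/-- `e^ρ ≤ 3` for `ρ ≤ 1`. [folklore] -/
theorem exp_le_three_of_le_one {ρ : ℝ} (h1 : ρ ≤ 1) : Real.exp ρ ≤ 3 :=
  (Real.exp_le_exp.2 h1).trans (by have := Real.exp_one_lt_d9; norm_num at this ⊢; linarith)

omit [NormedAlgebra ℝ 𝔸] [CompleteSpace 𝔸] in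
/-- the algebra of the first-order expansion: `e^PXe^{−P} − X − [P, X] = (e^P − 1 − P)X + X(e^{−P} − 1 + P) + (e^P − 1)X(e^{−P} − 1)` (with `e^{±P}` as letters). [folklore] -/
theorem conj_sub_sub_comm_eq (U V P X : 𝔸) : U * X * V - X - (P * X - X * P) = (U - 1 - P) * X + X * (V - 1 + P) + (U - 1) * X * (V - 1) := by
  noncomm_ring

omit [NormedAlgebra ℝ 𝔸] [CompleteSpace 𝔸] in
/-- the algebra of the two-point expansion. [folklore] -/
theorem conj_sub_conj_sub_comm_eq (U V U₂ V₂ D X : 𝔸) :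
    U * X * V - U₂ * X * V₂ - (D * X - X * D) = (U - U₂ - D) * X + X * (V - V₂ + D) + (U - U₂) * X * (V - 1) + (U₂ - 1) * X * (V - V₂) := by
  noncomm_ring

/-- ★ FIRST ORDER OF THE ADJOINT ACTION: `‖e^P X e^{−P} − X − [P, X]‖ ≤ 8ρ²‖X‖` for `‖P‖ ≤ ρ ≤ 1`. [folklore] -/
theorem norm_conj_exp_sub_sub_comm_le {P : 𝔸} {ρ : ℝ} (hP : ‖P‖ ≤ ρ) (hρ1 : ρ ≤ 1) (X : 𝔸) :
    ‖exp P * X * exp (-P) - X - (P * X - X * P)‖ ≤ 8 * ρ ^ 2 * ‖X‖ := by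
  have hρ0 : 0 ≤ ρ := (norm_nonneg _).trans hP
  have hE : Real.exp ρ - 1 ≤ 2 * ρ := by   -- (the T⁴ cell's `real_exp_sub_one_le_two_mul`, inlined: Mathlib `Real.abs_exp_sub_one_le`)
    have h := Real.abs_exp_sub_one_le (x := ρ) (by rwa [abs_of_nonneg hρ0])
    rw [abs_of_nonneg hρ0] at h
    exact (le_abs_self _).trans h
  have hE0 : 0 ≤ Real.exp ρ - 1 := by linarith [Real.add_one_le_exp ρ]
  have hEP : Real.exp ‖P‖ - 1 ≤ Real.exp ρ - 1 := by gcongr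
  have hEP0 : 0 ≤ Real.exp ‖P‖ - 1 := by linarith [Real.add_one_le_exp ‖P‖, norm_nonneg P]
  have hEnP : Real.exp ‖-P‖ - 1 ≤ Real.exp ρ - 1 := by rw [norm_neg]; exact hEP
  have hp : ‖exp P - 1‖ ≤ 2 * ρ := (norm_exp_sub_one_le P).trans (hEP.trans hE)
  have hq : ‖exp (-P) - 1‖ ≤ 2 * ρ := (norm_exp_sub_one_le (-P)).trans (hEnP.trans hE)
  have hpP : ‖exp P - 1 - P‖ ≤ ρ * (2 * ρ) :=
    (norm_exp_sub_one_sub_self_le P).trans (mul_le_mul hP (hEP.trans hE) hEP0 hρ0)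
  have hqP : ‖exp (-P) - 1 + P‖ ≤ ρ * (2 * ρ) := by
    have h := norm_exp_sub_one_sub_self_le (-P)
    rw [sub_neg_eq_add, norm_neg] at h
    exact h.trans (mul_le_mul hP (hEP.trans hE) hEP0 hρ0)
  rw [conj_sub_sub_comm_eq]
  have hX := norm_nonneg X
  calc ‖(exp P - 1 - P) * X + X * (exp (-P) - 1 + P) + (exp P - 1) * X * (exp (-P) - 1)‖
      ≤ ‖exp P - 1 - P‖ * ‖X‖ + ‖X‖ * ‖exp (-P) - 1 + P‖ + ‖exp P - 1‖ * ‖X‖ * ‖exp (-P) - 1‖ := by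
        refine (norm_add_le _ _).trans (add_le_add ((norm_add_le _ _).trans (add_le_add (norm_mul_le _ _) (norm_mul_le _ _))) ?_)
        exact (norm_mul_le _ _).trans (mul_le_mul_of_nonneg_right (norm_mul_le _ _) (norm_nonneg _))
    _ ≤ ρ * (2 * ρ) * ‖X‖ + ‖X‖ * (ρ * (2 * ρ)) + 2 * ρ * ‖X‖ * (2 * ρ) := by
        gcongr
    _ = 8 * ρ ^ 2 * ‖X‖ := by ring

/-- ★ TWO POINTS: `‖e^PXe^{−P} − e^QXe^{−Q} − [P − Q, X]‖ ≤ 16ρ·‖P − Q‖·‖X‖` for `‖P‖, ‖Q‖ ≤ ρ ≤ 1` (Duhamel–Lipschitz for the exponential, second order). [folklore] -/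
theorem norm_conj_exp_sub_conj_exp_sub_comm_le {P Q : 𝔸} {ρ : ℝ} (hP : ‖P‖ ≤ ρ) (hQ : ‖Q‖ ≤ ρ) (hρ1 : ρ ≤ 1) (X : 𝔸) :
    ‖exp P * X * exp (-P) - exp Q * X * exp (-Q) - ((P - Q) * X - X * (P - Q))‖ ≤ 16 * ρ * ‖P - Q‖ * ‖X‖ := by
  have hρ0 : 0 ≤ ρ := (norm_nonneg _).trans hP
  have hE : Real.exp ρ - 1 ≤ 2 * ρ := by   -- (the T⁴ cell's `real_exp_sub_one_le_two_mul`, inlined: Mathlib `Real.abs_exp_sub_one_le`)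
    have h := Real.abs_exp_sub_one_le (x := ρ) (by rwa [abs_of_nonneg hρ0])
    rw [abs_of_nonneg hρ0] at h
    exact (le_abs_self _).trans h
  have hE3 : Real.exp ρ ≤ 3 := exp_le_three_of_le_one hρ1
  have hnP : ‖-P‖ ≤ ρ := by rwa [norm_neg]
  have hnQ : ‖-Q‖ ≤ ρ := by rwa [norm_neg]
  have hPQ := norm_nonneg (P - Q)
  have h1 : ‖exp P - exp Q - (P - Q)‖ ≤ 2 * ρ * ‖P - Q‖ :=
    (norm_exp_sub_exp_sub_sub_le hP hQ).trans (mul_le_mul_of_nonneg_right hE hPQ)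
  have h2 : ‖exp (-P) - exp (-Q) + (P - Q)‖ ≤ 2 * ρ * ‖P - Q‖ := by
    have h := norm_exp_sub_exp_sub_sub_le hnP hnQ
    rw [show (-P) - (-Q) = -(P - Q) by abel, sub_neg_eq_add, norm_neg] at h
    exact h.trans (mul_le_mul_of_nonneg_right hE hPQ)
  have h3 : ‖exp P - exp Q‖ ≤ 3 * ‖P - Q‖ := (norm_exp_sub_exp_le hP hQ).trans (mul_le_mul_of_nonneg_right hE3 hPQ)
  have h4 : ‖exp (-P) - exp (-Q)‖ ≤ 3 * ‖P - Q‖ := by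
    have h := norm_exp_sub_exp_le hnP hnQ
    rw [show (-P) - (-Q) = -(P - Q) by abel, norm_neg] at h
    exact h.trans (mul_le_mul_of_nonneg_right hE3 hPQ)
  have hE5 : Real.exp ‖-P‖ - 1 ≤ Real.exp ρ - 1 := by gcongr
  have hE6 : Real.exp ‖Q‖ - 1 ≤ Real.exp ρ - 1 := by gcongr
  have h5 : ‖exp (-P) - 1‖ ≤ 2 * ρ := (norm_exp_sub_one_le (-P)).trans (hE5.trans hE)
  have h6 : ‖exp Q - 1‖ ≤ 2 * ρ := (norm_exp_sub_one_le Q).trans (hE6.trans hE)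
  rw [conj_sub_conj_sub_comm_eq]
  have hX := norm_nonneg X
  calc ‖(exp P - exp Q - (P - Q)) * X + X * (exp (-P) - exp (-Q) + (P - Q)) + (exp P - exp Q) * X * (exp (-P) - 1) + (exp Q - 1) * X * (exp (-P) - exp (-Q))‖
      ≤ ‖exp P - exp Q - (P - Q)‖ * ‖X‖ + ‖X‖ * ‖exp (-P) - exp (-Q) + (P - Q)‖ + ‖exp P - exp Q‖ * ‖X‖ * ‖exp (-P) - 1‖ + ‖exp Q - 1‖ * ‖X‖ * ‖exp (-P) - exp (-Q)‖ := by
        refine (norm_add_le _ _).trans (add_le_add ((norm_add_le _ _).trans (add_le_add ((norm_add_le _ _).trans (add_le_add (norm_mul_le _ _) (norm_mul_le _ _))) ?_)) ?_)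
        · exact (norm_mul_le _ _).trans (mul_le_mul_of_nonneg_right (norm_mul_le _ _) (norm_nonneg _))
        · exact (norm_mul_le _ _).trans (mul_le_mul_of_nonneg_right (norm_mul_le _ _) (norm_nonneg _))
    _ ≤ 2 * ρ * ‖P - Q‖ * ‖X‖ + ‖X‖ * (2 * ρ * ‖P - Q‖) + 3 * ‖P - Q‖ * ‖X‖ * (2 * ρ) + 2 * ρ * ‖X‖ * (3 * ‖P - Q‖) := by
        gcongr
    _ = 16 * ρ * ‖P - Q‖ * ‖X‖ := by ring

/-- ★ **THE SCALED ADJOINT ACTIONS AT TWO SPACINGS**: `‖n′(1 − Ad_{e^{B′/n′}}) − n(1 − Ad_{e^{B/n}})‖ ≤ 2‖B′ − B‖ + 8r²(1/n′ + 1/n)` for `‖B‖, ‖B′‖ ≤ r ≤ 1`, `n, n′ ≥ 1`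
(`n(Ad_{e^{B/n}} − 1) = ad_B + O(r²/n)` on each grid; `ad` is `2`-Lipschitz). [cite: Balaban1985BackgroundPropagators, (3.35)–(3.37) p.396, (3.50) p.400 (shapes)] -/
theorem norm_scaledAd_two_grid_le (n n' : ℕ) [NeZero n] [NeZero n'] {B B' : 𝔸} {r : ℝ} (hB : ‖B‖ ≤ r) (hB' : ‖B'‖ ≤ r) (hr1 : r ≤ 1) :
    ‖(n' : ℝ) • ((1 : 𝔸 →L[ℝ] 𝔸) - ContinuousLinearMap.mulLeftRight ℝ 𝔸 (exp (((n' : ℕ) : ℝ)⁻¹ • B')) (exp (-((((n' : ℕ) : ℝ)⁻¹ • B'))))) -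
        (n : ℝ) • ((1 : 𝔸 →L[ℝ] 𝔸) - ContinuousLinearMap.mulLeftRight ℝ 𝔸 (exp (((n : ℕ) : ℝ)⁻¹ • B)) (exp (-((((n : ℕ) : ℝ)⁻¹ • B)))))‖ ≤
      2 * ‖B' - B‖ + 8 * r ^ 2 * ((((n' : ℕ) : ℝ))⁻¹ + (((n : ℕ) : ℝ))⁻¹) := by
  have hr0 : 0 ≤ r := (norm_nonneg _).trans hB
  have hn : (0 : ℝ) < (n : ℝ) := Nat.cast_pos.mpr (Nat.pos_of_ne_zero (NeZero.ne n))
  have hn' : (0 : ℝ) < (n' : ℝ) := Nat.cast_pos.mpr (Nat.pos_of_ne_zero (NeZero.ne n'))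
  have hn1 : (1 : ℝ) ≤ (n : ℝ) := by exact_mod_cast Nat.one_le_iff_ne_zero.mpr (NeZero.ne n)
  have hn1' : (1 : ℝ) ≤ (n' : ℝ) := by exact_mod_cast Nat.one_le_iff_ne_zero.mpr (NeZero.ne n')
  -- the local step: `‖n(e^{B/n}Xe^{−B/n} − X) − [B, X]‖ ≤ 8r²/n·‖X‖`
  have step : ∀ (k : ℕ) (C : 𝔸), (1 : ℝ) ≤ (k : ℝ) → ‖C‖ ≤ r → ∀ X : 𝔸,
      ‖(k : ℝ) • (exp (((k : ℕ) : ℝ)⁻¹ • C) * X * exp (-((((k : ℕ) : ℝ)⁻¹ • C))) - X) - (C * X - X * C)‖ ≤ 8 * r ^ 2 * (((k : ℕ) : ℝ))⁻¹ * ‖X‖ := by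
    intro k C hk hC X
    have hk0 : (0 : ℝ) < (k : ℝ) := by linarith
    have hkinv : (0 : ℝ) ≤ ((k : ℝ))⁻¹ := by positivity
    have hPn : ‖(((k : ℕ) : ℝ))⁻¹ • C‖ ≤ (((k : ℕ) : ℝ))⁻¹ * r := by
      rw [norm_smul, Real.norm_of_nonneg hkinv]; exact mul_le_mul_of_nonneg_left hC hkinv
    have hρ1 : (((k : ℕ) : ℝ))⁻¹ * r ≤ 1 := by
      rw [inv_mul_le_iff₀ hk0]; nlinarith
    have h := norm_conj_exp_sub_sub_comm_le hPn hρ1 X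
    have hid : (k : ℝ) • (exp (((k : ℕ) : ℝ)⁻¹ • C) * X * exp (-((((k : ℕ) : ℝ)⁻¹ • C))) - X) - (C * X - X * C) =
        (k : ℝ) • (exp (((k : ℕ) : ℝ)⁻¹ • C) * X * exp (-((((k : ℕ) : ℝ)⁻¹ • C))) - X - (((((k : ℕ) : ℝ))⁻¹ • C) * X - X * ((((k : ℕ) : ℝ))⁻¹ • C))) := by
      simp only [smul_sub, smul_mul_assoc, mul_smul_comm, smul_smul, mul_inv_cancel₀ hk0.ne', one_smul]
    rw [hid, norm_smul, Real.norm_of_nonneg hk0.le]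
    calc (k : ℝ) * ‖exp (((k : ℕ) : ℝ)⁻¹ • C) * X * exp (-((((k : ℕ) : ℝ)⁻¹ • C))) - X - (((((k : ℕ) : ℝ))⁻¹ • C) * X - X * ((((k : ℕ) : ℝ))⁻¹ • C))‖
        ≤ (k : ℝ) * (8 * ((((k : ℕ) : ℝ))⁻¹ * r) ^ 2 * ‖X‖) := mul_le_mul_of_nonneg_left h hk0.le
      _ = 8 * r ^ 2 * (((k : ℕ) : ℝ))⁻¹ * ‖X‖ := by field_simp
  refine ContinuousLinearMap.opNorm_le_bound _ (by positivity) fun X => ?_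
  have e1 : ((n' : ℝ) • ((1 : 𝔸 →L[ℝ] 𝔸) - ContinuousLinearMap.mulLeftRight ℝ 𝔸 (exp (((n' : ℕ) : ℝ)⁻¹ • B')) (exp (-((((n' : ℕ) : ℝ)⁻¹ • B'))))) -
        (n : ℝ) • ((1 : 𝔸 →L[ℝ] 𝔸) - ContinuousLinearMap.mulLeftRight ℝ 𝔸 (exp (((n : ℕ) : ℝ)⁻¹ • B)) (exp (-((((n : ℕ) : ℝ)⁻¹ • B)))))) X =
      ((n : ℝ) • (exp (((n : ℕ) : ℝ)⁻¹ • B) * X * exp (-((((n : ℕ) : ℝ)⁻¹ • B))) - X) - (B * X - X * B)) -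
        ((n' : ℝ) • (exp (((n' : ℕ) : ℝ)⁻¹ • B') * X * exp (-((((n' : ℕ) : ℝ)⁻¹ • B'))) - X) - (B' * X - X * B')) -
        ((B' - B) * X - X * (B' - B)) := by
    simp only [sub_apply, smul_apply, one_apply_eq_self, ContinuousLinearMap.mulLeftRight_apply, smul_sub]
    noncomm_ring
  rw [e1]
  have hX := norm_nonneg X
  calc _ ≤ ‖(n : ℝ) • (exp (((n : ℕ) : ℝ)⁻¹ • B) * X * exp (-((((n : ℕ) : ℝ)⁻¹ • B))) - X) - (B * X - X * B)‖ +
          ‖(n' : ℝ) • (exp (((n' : ℕ) : ℝ)⁻¹ • B') * X * exp (-((((n' : ℕ) : ℝ)⁻¹ • B'))) - X) - (B' * X - X * B')‖ + ‖(B' - B) * X - X * (B' - B)‖ :=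
        (norm_sub_le _ _).trans (add_le_add (norm_sub_le _ _) le_rfl)
    _ ≤ 8 * r ^ 2 * (((n : ℕ) : ℝ))⁻¹ * ‖X‖ + 8 * r ^ 2 * (((n' : ℕ) : ℝ))⁻¹ * ‖X‖ + (‖B' - B‖ * ‖X‖ + ‖X‖ * ‖B' - B‖) :=
        add_le_add (add_le_add (step n B hn1 hB X) (step n' B' hn1' hB' X)) ((norm_sub_le _ _).trans (add_le_add (norm_mul_le _ _) (norm_mul_le _ _)))
    _ = (2 * ‖B' - B‖ + 8 * r ^ 2 * ((((n' : ℕ) : ℝ))⁻¹ + (((n : ℕ) : ℝ))⁻¹)) * ‖X‖ := by ring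

/-- ★ **THE GRADIENT WORD**: `‖n²(Ad_{e^{B₁/n}} − Ad_{e^{B₂/n}}) − ad_{n(B₁ − B₂)}‖ ≤ 16r‖B₁ − B₂‖` for `‖B₁‖, ‖B₂‖ ≤ r ≤ 1`, `n ≥ 1` (pointwise form; the word of the lattice
divergence `div_n(n(1 − T))`). [cite: Balaban1985BackgroundPropagators, (3.35) p.396, (3.50)–(3.52) p.400 (shapes)] -/
theorem norm_scaledAdDiff_sub_comm_le (n : ℕ) [NeZero n] {B₁ B₂ : 𝔸} {r : ℝ} (hB₁ : ‖B₁‖ ≤ r) (hB₂ : ‖B₂‖ ≤ r) (hr1 : r ≤ 1) (X : 𝔸) :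
    ‖(n : ℝ) • ((n : ℝ) • (exp (((n : ℕ) : ℝ)⁻¹ • B₁) * X * exp (-((((n : ℕ) : ℝ)⁻¹ • B₁))) - exp (((n : ℕ) : ℝ)⁻¹ • B₂) * X * exp (-((((n : ℕ) : ℝ)⁻¹ • B₂))))) -
        (((n : ℝ) • (B₁ - B₂)) * X - X * ((n : ℝ) • (B₁ - B₂)))‖ ≤ 16 * r * ‖B₁ - B₂‖ * ‖X‖ := by
  have hr0 : 0 ≤ r := (norm_nonneg _).trans hB₁
  have hn : (0 : ℝ) < (n : ℝ) := Nat.cast_pos.mpr (Nat.pos_of_ne_zero (NeZero.ne n))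
  have hn1 : (1 : ℝ) ≤ (n : ℝ) := by exact_mod_cast Nat.one_le_iff_ne_zero.mpr (NeZero.ne n)
  have hkinv : (0 : ℝ) ≤ ((n : ℝ))⁻¹ := by positivity
  have hP : ∀ C : 𝔸, ‖C‖ ≤ r → ‖(((n : ℕ) : ℝ))⁻¹ • C‖ ≤ (((n : ℕ) : ℝ))⁻¹ * r := fun C hC => by
    rw [norm_smul, Real.norm_of_nonneg hkinv]; exact mul_le_mul_of_nonneg_left hC hkinv
  have hρ1 : (((n : ℕ) : ℝ))⁻¹ * r ≤ 1 := by rw [inv_mul_le_iff₀ hn]; nlinarith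
  have h := norm_conj_exp_sub_conj_exp_sub_comm_le (hP B₁ hB₁) (hP B₂ hB₂) hρ1 X
  rw [← smul_sub] at h
  generalize B₁ - B₂ = D at h ⊢
  have hid : (n : ℝ) • ((n : ℝ) • (exp (((n : ℕ) : ℝ)⁻¹ • B₁) * X * exp (-((((n : ℕ) : ℝ)⁻¹ • B₁))) - exp (((n : ℕ) : ℝ)⁻¹ • B₂) * X * exp (-((((n : ℕ) : ℝ)⁻¹ • B₂))))) -
        (((n : ℝ) • D) * X - X * ((n : ℝ) • D)) =
      ((n : ℝ) * (n : ℝ)) • (exp (((n : ℕ) : ℝ)⁻¹ • B₁) * X * exp (-((((n : ℕ) : ℝ)⁻¹ • B₁))) - exp (((n : ℕ) : ℝ)⁻¹ • B₂) * X * exp (-((((n : ℕ) : ℝ)⁻¹ • B₂))) -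
        (((((n : ℕ) : ℝ))⁻¹ • D) * X - X * ((((n : ℕ) : ℝ))⁻¹ • D))) := by
    simp only [smul_sub, smul_mul_assoc, mul_smul_comm, smul_smul, mul_inv_cancel_right₀ hn.ne']
  rw [hid, norm_smul, Real.norm_of_nonneg (by positivity)]
  calc (n : ℝ) * (n : ℝ) * ‖exp (((n : ℕ) : ℝ)⁻¹ • B₁) * X * exp (-((((n : ℕ) : ℝ)⁻¹ • B₁))) - exp (((n : ℕ) : ℝ)⁻¹ • B₂) * X * exp (-((((n : ℕ) : ℝ)⁻¹ • B₂))) -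
        (((((n : ℕ) : ℝ))⁻¹ • D) * X - X * ((((n : ℕ) : ℝ))⁻¹ • D))‖
      ≤ (n : ℝ) * (n : ℝ) * (16 * ((((n : ℕ) : ℝ))⁻¹ * r) * ‖(((n : ℕ) : ℝ))⁻¹ • D‖ * ‖X‖) := mul_le_mul_of_nonneg_left h (by positivity)
    _ = 16 * r * ‖D‖ * ‖X‖ := by
        rw [norm_smul, Real.norm_of_nonneg hkinv]
        field_simp

end AdExpansion

end Summit.QuantumFields.YangMills.BalabanUVNodes.N15.MatrixSpecies

/-! ## §2 The oscillation letter `ω_N` of the knit's transporters -/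

namespace Summit.QuantumFields.YangMills.BalabanUVNodes.N15.Gluing

open Literature.MathematicalPhysics.QuantumFieldTheory.Balaban1983to89
open Literature.MathematicalPhysics.QuantumFieldTheory.Balaban1983to89.B5Prop11Plancherel (Tor fine unitVec)
open Summit.QuantumFields.YangMills.BalabanUVNodes.N15.MatrixSpecies (coordMat basisConst basisConst_nonneg coordMat_sub norm_scaledAd_two_grid_le)
open Summit.QuantumFields.YangMills.BalabanUVNodes.N15.BackgroundLayer (gavgM coordMat_one coordMat_smul)
open Summit.QuantumFields.YangMills.BalabanUVNodes.N15.CurvedSpecies (conjTranspose_exp_smul_of_conjTranspose abs_coordMat_entry_le)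
open Summit.QuantumFields.YangMills.BalabanUVNodes.N15.VectorPiece (kingPr kingPrV bshiftEquiv)
open Summit.QuantumFields.YangMills.BalabanUVNodes.N15.CovAvg (norm_sub_gavgM_kingPrV_le)

variable {d : ℕ} {L : ℕ} [NeZero L]

section OmegaN

open scoped Matrix.Norms.L2Operator

variable (M : Fin (d + 1) → ℕ) [∀ μ, NeZero (M μ)] (k m : ℕ) {ι : Type} [Fintype ι] [DecidableEq ι]
  {mm : Type} [Fintype mm] [DecidableEq mm] (e : Matrix mm mm ℂ ≃L[ℝ] (ι → ℝ))

/-- the letter `n(1 − T)` of an exponential site datum is the coordinate matrix of `n(1 − Ad_{e^{A/n}})` (skewness: `(e^{A/n})ᴴ = e^{−A/n}`). [folklore] -/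
theorem smul_one_sub_cvT₀_exp_eq (nn : ℕ) [NeZero nn] {A : Fin (d + 1) → Tor (fine nn M) × Fin (d + 1) → Matrix mm mm ℂ} (hAs : ∀ μ p, (A μ p)ᴴ = -A μ p)
    (ν : Fin (d + 1)) (x : Tor (fine nn M)) :
    ((nn : ℕ) : ℝ) • ((1 : Matrix ι ι ℝ) - cvT₀ e (fun μ p => NormedSpace.exp ((((nn : ℕ) : ℝ))⁻¹ • A μ p)) ν x) =
      coordMat e (((nn : ℕ) : ℝ) • ((1 : Matrix mm mm ℂ →L[ℝ] Matrix mm mm ℂ) -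
        ContinuousLinearMap.mulLeftRight ℝ (Matrix mm mm ℂ) (NormedSpace.exp ((((nn : ℕ) : ℝ))⁻¹ • A ν (x, ν))) (NormedSpace.exp (-(((((nn : ℕ) : ℝ))⁻¹ • A ν (x, ν))))))) := by
  rw [coordMat_smul, coordMat_sub, coordMat_one, cvT₀, conjTranspose_exp_smul_of_conjTranspose (hAs ν (x, ν))]

/-- ★★ **THE OSCILLATION LETTER `ω_N`, ENTRYWISE**: for the fine field `A′` (skew, `‖A′‖ ≤ r ≤ 1`, unit steps `≤ ℓ′`) and its King block mean `Ā = gavgM π̂ A′`,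
`|(n′(1 − T′_ν(x′)) − n(1 − T_ν(pr x′)))_{ij}| ≤ κ_e·(2·2(d+1)(L^m−1)·ℓ′ + 8r²(1/n′ + 1/n))`, `T′ = cvT₀ e e^{A′/n′}`, `T = cvT₀ e e^{Ā/n}`, `n = L^k`, `n′ = L^mL^k`.
[cite: Balaban1985BackgroundPropagators, (3.35)–(3.37) p.396, Thm 3.14 pp.426–427 (two spacings: shape); King1986, p.664 (pairing)] -/
theorem omegaN_entry_le {A' : Fin (d + 1) → Tor (fine (L ^ m * L ^ k) M) × Fin (d + 1) → Matrix mm mm ℂ} (hAs : ∀ μ p, (A' μ p)ᴴ = -A' μ p) {r ℓ' : ℝ} (hr1 : r ≤ 1)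
    (hA : ∀ μ p, ‖A' μ p‖ ≤ r) (hstep : ∀ μ κ b', ‖A' μ (bshiftEquiv M (L ^ m * L ^ k) κ b') - A' μ b'‖ ≤ ℓ') (ν : Fin (d + 1)) (x' : Tor (fine (L ^ m * L ^ k) M)) (i j : ι) :
    |((((L ^ m * L ^ k : ℕ) : ℝ)) • ((1 : Matrix ι ι ℝ) - cvT₀ e (fun μ p => NormedSpace.exp (((((L ^ m * L ^ k : ℕ) : ℝ))⁻¹) • A' μ p)) ν x') -
        (((L ^ k : ℕ) : ℝ)) • ((1 : Matrix ι ι ℝ) - cvT₀ e (fun μ p => NormedSpace.exp (((((L ^ k : ℕ) : ℝ))⁻¹) • gavgM (Matrix mm mm ℂ) (Fin (d + 1)) (kingPrV L k m M) A' μ p)) ν (kingPr L k m M x'))) i j| ≤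
      basisConst e * (2 * ((2 * ((d + 1) * (L ^ m - 1)) : ℕ) * ℓ') + 8 * r ^ 2 * (((((L ^ m * L ^ k : ℕ) : ℝ)))⁻¹ + ((((L ^ k : ℕ) : ℝ)))⁻¹)) := by
  have hr0 : 0 ≤ r := (norm_nonneg _).trans (hA 0 (x', 0))
  have hĀs : ∀ μ p, (gavgM (Matrix mm mm ℂ) (Fin (d + 1)) (kingPrV L k m M) A' μ p)ᴴ = -gavgM (Matrix mm mm ℂ) (Fin (d + 1)) (kingPrV L k m M) A' μ p :=
    fun μ p => gavgM_conjTranspose_of_skew (kingPrV L k m M) hAs μ p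
  have hĀ : ∀ μ p, ‖gavgM (Matrix mm mm ℂ) (Fin (d + 1)) (kingPrV L k m M) A' μ p‖ ≤ r :=
    fun μ p => MatrixSpecies.norm_blockAvgV_le (kingPrV L k m M) hr0 (hA μ) p
  rw [smul_one_sub_cvT₀_exp_eq M e _ hAs, smul_one_sub_cvT₀_exp_eq M e _ hĀs, ← coordMat_sub]
  refine (abs_coordMat_entry_le e _ i j).trans (mul_le_mul_of_nonneg_left ?_ (basisConst_nonneg e))
  refine (norm_scaledAd_two_grid_le (L ^ k) (L ^ m * L ^ k) (hĀ ν (kingPr L k m M x', ν)) (hA ν (x', ν)) hr1).trans ?_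
  have hfit := norm_sub_gavgM_kingPrV_le M L k m hstep ν (x', ν)
  gcongr
  exact hfit

/-- ★★ **ROWS OF `ω_N`** (243's `hωNr`): `Σ_j |(N′_ν(x′) − N_ν(pr x′))_{ij}| ≤ |ι|·κ_e·(2·2(d+1)(L^m−1)·ℓ′ + 8r²(1/n′ + 1/n))`. [cite: Balaban1985BackgroundPropagators, (3.35) p.396, Thm 3.14 pp.426–427 (shape)] -/
theorem omegaN_rows_le {A' : Fin (d + 1) → Tor (fine (L ^ m * L ^ k) M) × Fin (d + 1) → Matrix mm mm ℂ} (hAs : ∀ μ p, (A' μ p)ᴴ = -A' μ p) {r ℓ' : ℝ} (hr1 : r ≤ 1)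
    (hA : ∀ μ p, ‖A' μ p‖ ≤ r) (hstep : ∀ μ κ b', ‖A' μ (bshiftEquiv M (L ^ m * L ^ k) κ b') - A' μ b'‖ ≤ ℓ') (ν : Fin (d + 1)) (x' : Tor (fine (L ^ m * L ^ k) M)) (i : ι) :
    ∑ j, |((((L ^ m * L ^ k : ℕ) : ℝ)) • ((1 : Matrix ι ι ℝ) - cvT₀ e (fun μ p => NormedSpace.exp (((((L ^ m * L ^ k : ℕ) : ℝ))⁻¹) • A' μ p)) ν x') -
        (((L ^ k : ℕ) : ℝ)) • ((1 : Matrix ι ι ℝ) - cvT₀ e (fun μ p => NormedSpace.exp (((((L ^ k : ℕ) : ℝ))⁻¹) • gavgM (Matrix mm mm ℂ) (Fin (d + 1)) (kingPrV L k m M) A' μ p)) ν (kingPr L k m M x'))) i j| ≤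
      Fintype.card ι * (basisConst e * (2 * ((2 * ((d + 1) * (L ^ m - 1)) : ℕ) * ℓ') + 8 * r ^ 2 * (((((L ^ m * L ^ k : ℕ) : ℝ)))⁻¹ + ((((L ^ k : ℕ) : ℝ)))⁻¹))) := by
  calc _ ≤ ∑ _j : ι, basisConst e * (2 * ((2 * ((d + 1) * (L ^ m - 1)) : ℕ) * ℓ') + 8 * r ^ 2 * (((((L ^ m * L ^ k : ℕ) : ℝ)))⁻¹ + ((((L ^ k : ℕ) : ℝ)))⁻¹)) :=
        Finset.sum_le_sum fun j _ => omegaN_entry_le M k m e hAs hr1 hA hstep ν x' i j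
    _ = _ := by rw [Finset.sum_const, Finset.card_univ, nsmul_eq_mul]

/-- ★★ **COLUMNS OF `ω_N`** (243's `hωNc`). [cite: Balaban1985BackgroundPropagators, (3.35) p.396, Thm 3.14 pp.426–427 (shape)] -/
theorem omegaN_cols_le {A' : Fin (d + 1) → Tor (fine (L ^ m * L ^ k) M) × Fin (d + 1) → Matrix mm mm ℂ} (hAs : ∀ μ p, (A' μ p)ᴴ = -A' μ p) {r ℓ' : ℝ} (hr1 : r ≤ 1)
    (hA : ∀ μ p, ‖A' μ p‖ ≤ r) (hstep : ∀ μ κ b', ‖A' μ (bshiftEquiv M (L ^ m * L ^ k) κ b') - A' μ b'‖ ≤ ℓ') (ν : Fin (d + 1)) (x' : Tor (fine (L ^ m * L ^ k) M)) (i : ι) :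
    ∑ j, |((((L ^ m * L ^ k : ℕ) : ℝ)) • ((1 : Matrix ι ι ℝ) - cvT₀ e (fun μ p => NormedSpace.exp (((((L ^ m * L ^ k : ℕ) : ℝ))⁻¹) • A' μ p)) ν x') -
        (((L ^ k : ℕ) : ℝ)) • ((1 : Matrix ι ι ℝ) - cvT₀ e (fun μ p => NormedSpace.exp (((((L ^ k : ℕ) : ℝ))⁻¹) • gavgM (Matrix mm mm ℂ) (Fin (d + 1)) (kingPrV L k m M) A' μ p)) ν (kingPr L k m M x'))) j i| ≤
      Fintype.card ι * (basisConst e * (2 * ((2 * ((d + 1) * (L ^ m - 1)) : ℕ) * ℓ') + 8 * r ^ 2 * (((((L ^ m * L ^ k : ℕ) : ℝ)))⁻¹ + ((((L ^ k : ℕ) : ℝ)))⁻¹))) := by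
  calc _ ≤ ∑ _j : ι, basisConst e * (2 * ((2 * ((d + 1) * (L ^ m - 1)) : ℕ) * ℓ') + 8 * r ^ 2 * (((((L ^ m * L ^ k : ℕ) : ℝ)))⁻¹ + ((((L ^ k : ℕ) : ℝ)))⁻¹)) :=
        Finset.sum_le_sum fun j _ => omegaN_entry_le M k m e hAs hr1 hA hstep ν x' j i
    _ = _ := by rw [Finset.sum_const, Finset.card_univ, nsmul_eq_mul]

end OmegaN

end Summit.QuantumFields.YangMills.BalabanUVNodes.N15.Gluing

end
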